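import Mathlib
import Summits.CriticalPhenomena.CardyFormulaZ2.Theorems.CardySelfRefinementDefs
import Summits.CriticalPhenomena.CardyFormulaZ2.Theorems.CardySelfRefinementRussoDriftModel
import Summits.CriticalPhenomena.CardyFormulaZ2.Theorems.CardySelfRefinementCriticalPathRSWStubPhaseDiagramLandmarksB
import Summits.CriticalPhenomena.CardyFormulaZ2.Theorems.CardySelfRefinementCriticalPathRSWStubRswOfCertificates3SandwichA
import Summits.CriticalPhenomena.CardyFormulaZ2.Theorems.CardySelfRefinementCriticalPathRSWStubRswOfCertificates3Primal
import Literature.Probability.Percolation.SelfRefinementMeasure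
import Literature.Probability.Percolation.KestenTheoremProofs
import HarnessLib

/-!
# Crux `GradientComparability` (stmt-CriticalPhenomena-10269), line `monotone-product-coordinates` —
# stub `stub_cornerHardWayBoxes` (HWB), brick (i): the endpoint `c = 0` of the extended family

Route `CardySelfRefinement`; vocabulary from `CardySelfRefinementDefs` (`ax`, `cfg`, `prm`, `M`).
The planned route to (HWB) (uniform supercriticality of `M_k(ρ, c₀)` just inside the corner `ρ = 1`,
Aizenman–Grimmett essential enhancement) runs through the **extended family** `M_k(1, c; p)`: the
coin law `prm k 1 c` with the fair SHARED coin of every bundle replaced by a coin of bias `p`, pushed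
forward by `cfg k`.  This file lands its endpoint `hardWayBoxes_one_of_half_lt` (REGISTERED): for
`k ≥ 1`, `p > 1/2`, every `c` and `ε > 0`, at all large scales `n` every translate of the `8n × n`
(`n × 8n`) rectangle of `√2 ℤ²` is crossed the long way with probability `≥ 1 - ε`.  At `c = 0` the
law is Bernoulli(`p`) bond percolation on `kℤ²` subdivided (`map_cfg_zero_one_eq_map_refineConfig`):
Kesten's theorem in the sharp-threshold form `h_p(ρ n, n) → 1` (Bollobás–Riordan 2006, Ch. 3,
Lemma 8, the tree's `BollobasRiordan2006_ch3_lemma8_holds`) on the coarse lattice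
(`long_crossings_map_refineConfig`), transported to embedded boxes by the lower sandwich
`RswCertSandwich.embRectCrossing_lower` of crux `CriticalPathRSW` (symmetries of
`(prodBernoulli P).map (cfg k)` for reindexing-invariant `P`: `map_cfg_map_relabel*`,
`admissible_map_cfg`), and raised to every `c` by the monotone coupling (`map_cfg_zero_le_map_cfg`).
-/

noncomputable section

namespace Summit.CriticalPhenomena.CardyFormulaZ2.Theorems.CardySelfRefinement

open scoped Topology
open Filter Set MeasureTheory
open Literature.Probability.LatticeModels Literature.Probability.Percolation
open Literature.Probability.Percolation.QuadCrossing
open Summit.CriticalPhenomena.CardyFormulaZ2.Theses.CardySelfRefinement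
open Summit.CriticalPhenomena.CardyFormulaZ2.Cruxes.CriticalPathRSW.FiniteSizeEnvelope

/-! ## Layered parameter vectors: lattice symmetries of `(prodBernoulli P).map (cfg k)` -/

/-- A layered parameter vector (own-coin bias a function of axiality, shared and selector biases
constant) is invariant under the coin reindexing induced by an axiality-preserving bijection of
the edge labels and any bijection of the tuple labels. -/
theorem param_coinReindex {k : ℕ} {P : Site 2 × Fin 2 × Fin 3 → unitInterval}
    (hP0 : ∀ e e' : Site 2 × Fin 2, (IsAxialEdge k e ↔ IsAxialEdge k e') →
      P (e.1, e.2, 0) = P (e'.1, e'.2, 0))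
    (hP1 : ∀ t t' : Site 2 × Fin 2, P (t.1, t.2, 1) = P (t'.1, t'.2, 1))
    (hP2 : ∀ t t' : Site 2 × Fin 2, P (t.1, t.2, 2) = P (t'.1, t'.2, 2))
    {πe : Site 2 × Fin 2 ≃ Site 2 × Fin 2} (πt : Site 2 × Fin 2 ≃ Site 2 × Fin 2)
    (h2 : ∀ e, IsAxialEdge k (πe e) ↔ IsAxialEdge k e) (i : Site 2 × Fin 2 × Fin 3) :
    P (coinReindex πe πt i) = P i := by
  obtain ⟨x, d, j⟩ := i
  fin_cases j
  · simpa using hP0 (πe (x, d)) (x, d) (h2 (x, d))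
  · simpa using hP1 (πt (x, d)) (x, d)
  · simpa using hP2 (πt (x, d)) (x, d)

/-- **Invariance principle** for `(prodBernoulli P).map (cfg k)`: if the automorphism `φ` of `ℤ²`
intertwines with the coin reindexing `coinReindex πe πt` (hypotheses of the tree's
`relabel_refinementConfig`) and `P` is reindexing-invariant, the push-forward is `φ`-invariant. -/
theorem map_cfg_map_relabel (k : ℕ) (P : Site 2 × Fin 2 × Fin 3 → unitInterval)
    (φ : zdGraph 2 ≃g zdGraph 2) {πe πt : Site 2 × Fin 2 ≃ Site 2 × Fin 2}
    (h1 : ∀ e, (sym2Equiv φ.toEquiv).symm (cornerEdge e) = cornerEdge (πe e))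
    (h2 : ∀ e, IsAxialEdge k (πe e) ↔ IsAxialEdge k e)
    (h3 : ∀ e, IsAxialEdge k e → πt (tupleBase k e, e.2) = (tupleBase k (πe e), (πe e).2))
    (hP : ∀ i, P (coinReindex πe πt i) = P i) :
    ((prodBernoulli P).map (cfg k)).map (BondConfig.relabel (sym2Equiv φ.toEquiv)) =
      (prodBernoulli P).map (cfg k) := by
  rw [Measure.map_map (MeasurableEquiv.measurable _) (measurable_cfg k),
    show (BondConfig.relabel (sym2Equiv φ.toEquiv)) ∘ cfg k =
      cfg k ∘ fun S => coinReindex πe πt ⁻¹' S from funext (relabel_refinementConfig k φ h1 h2 h3),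
    ← Measure.map_map (measurable_cfg k) (measurable_preimage_coinReindex πe πt),
    prodBernoulli_map_preimage _ (coinReindex πe πt).injective]
  congr 2
  exact funext hP

/-- Invariance of `(prodBernoulli P).map (cfg k)` under the translations of `kℤ²` (`k ≠ 0`,
reindexing-invariant `P`). -/
theorem map_cfg_map_relabel_shift {k : ℕ} (hk : k ≠ 0) {P : Site 2 × Fin 2 × Fin 3 → unitInterval}
    (hP : ∀ πe πt : Site 2 × Fin 2 ≃ Site 2 × Fin 2, (∀ e, IsAxialEdge k (πe e) ↔ IsAxialEdge k e) →
      ∀ i, P (coinReindex πe πt i) = P i) (a : Site 2) :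
    ((prodBernoulli P).map (cfg k)).map (BondConfig.relabel (sym2Equiv (Site.shift ((k : ℤ) • a)))) =
      (prodBernoulli P).map (cfg k) := by
  refine map_cfg_map_relabel k P (zdShiftIso ((k : ℤ) • a)) (πe := shiftEdge k a)
    (πt := shiftTuple a) (fun e => ?_) (isAxialEdge_shiftEdge k a) (fun e _ => ?_)
    (hP _ _ (isAxialEdge_shiftEdge k a))
  · obtain ⟨v, d⟩ := e
    rw [shiftEdge_apply]
    exact sym2Equiv_symm_cornerEdge_shift _ v d
  · rw [shiftTuple_apply, tupleBase_shiftEdge hk]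
    obtain ⟨v, d⟩ := e
    simp

/-- Invariance of `(prodBernoulli P).map (cfg k)` under the transposition of the axes
(reindexing-invariant `P`). -/
theorem map_cfg_map_relabel_transpose (k : ℕ) {P : Site 2 × Fin 2 × Fin 3 → unitInterval}
    (hP : ∀ πe πt : Site 2 × Fin 2 ≃ Site 2 × Fin 2, (∀ e, IsAxialEdge k (πe e) ↔ IsAxialEdge k e) →
      ∀ i, P (coinReindex πe πt i) = P i) :
    ((prodBernoulli P).map (cfg k)).map (BondConfig.relabel (sym2Equiv transposeIso.toEquiv)) =
      (prodBernoulli P).map (cfg k) := by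
  refine map_cfg_map_relabel k P transposeIso (πe := transposeLabel) (πt := transposeLabel)
    (fun e => ?_) (isAxialEdge_transposeLabel k) (fun e _ => ?_)
    (hP _ _ (isAxialEdge_transposeLabel k))
  · obtain ⟨v, d⟩ := e
    rw [transposeIso_toEquiv, transposeLabel_apply]
    exact sym2Equiv_symm_cornerEdge_transpose v d
  · rw [tupleBase_transposeLabel]
    obtain ⟨v, d⟩ := e
    simp

/-- Invariance of `(prodBernoulli P).map (cfg k)` under the reflection `x ↦ (-x₀, x₁)` (`k ≠ 0`,
reindexing-invariant `P`). -/
theorem map_cfg_map_relabel_reflect {k : ℕ} (hk : k ≠ 0) {P : Site 2 × Fin 2 × Fin 3 → unitInterval}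
    (hP : ∀ πe πt : Site 2 × Fin 2 ≃ Site 2 × Fin 2, (∀ e, IsAxialEdge k (πe e) ↔ IsAxialEdge k e) →
      ∀ i, P (coinReindex πe πt i) = P i) :
    ((prodBernoulli P).map (cfg k)).map
        (BondConfig.relabel (sym2Equiv (reflectIso (0 : Fin 2)).toEquiv)) =
      (prodBernoulli P).map (cfg k) :=
  map_cfg_map_relabel k P (reflectIso 0) (πe := reflectLabel) (πt := reflectLabel)
    (fun e => sym2Equiv_symm_cornerEdge_reflect e.1 e.2) (isAxialEdge_reflectLabel k)
    (fun _ hax => reflectLabel_tupleBase hk hax)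
    (hP _ _ (isAxialEdge_reflectLabel k))

/-- Every push-forward `(prodBernoulli P).map (cfg k)` is carried by lattice configurations. -/
theorem latticeCarried_map_cfg (k : ℕ) (P : Site 2 × Fin 2 × Fin 3 → unitInterval) :
    KSTPeriodic.LatticeCarried ((prodBernoulli P).map (cfg k)) := by
  rw [KSTPeriodic.LatticeCarried, ae_iff,
    show {ω : BondConfig (Site 2) | ¬ ω ⊆ (zdGraph 2).edgeSet} = nnSupportᶜ from rfl,
    Measure.map_apply (measurable_cfg k) measurableSet_nnSupport.compl,
    Set.eq_empty_of_forall_notMem fun S (hS : S ∈ cfg k ⁻¹' nnSupportᶜ) => hS (cfg_subset_edgeSet k S),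
    measure_empty]

/-- **Admissibility** (`KSTPeriodic.Admissible k 0`) of `(prodBernoulli P).map (cfg k)` for a
reindexing-invariant `P` and `k ≠ 0`, given its positive association (`flipEquiv 0 = reflectIso 0`). -/
theorem admissible_map_cfg {k : ℕ} (hk : k ≠ 0) {P : Site 2 × Fin 2 × Fin 3 → unitInterval}
    (hP : ∀ πe πt : Site 2 × Fin 2 ≃ Site 2 × Fin 2, (∀ e, IsAxialEdge k (πe e) ↔ IsAxialEdge k e) →
      ∀ i, P (coinReindex πe πt i) = P i)
    (hFKG : IsPositivelyAssociated ((prodBernoulli P).map (cfg k))) :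
    KSTPeriodic.Admissible k 0 ((prodBernoulli P).map (cfg k)) where
  shift_inv v := map_cfg_map_relabel_shift hk hP v
  transpose_inv := map_cfg_map_relabel_transpose k hP
  flip_inv := by
    rw [RswCert.flipEquiv_zero_eq]
    exact map_cfg_map_relabel_reflect hk hP
  posAssoc := hFKG

/-! ## The extended family at `ρ = 1`: the endpoint `c = 0` and monotonicity in `c` -/

/-- **At `ρ = 1`, `c = 0` the extended law is Bernoulli(`q`) bond percolation on `kℤ²`,
subdivided**: the selectors are a.s. on, so every bundle copies its shared coin (bias `q`), and the
interior edges are a.s. closed (as `selfRefinementMeasure_one_zero`, the case `q = 1/2`). -/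
theorem map_cfg_zero_one_eq_map_refineConfig (k : ℕ) (q : unitInterval) :
    (prodBernoulli (fun i : Site 2 × Fin 2 × Fin 3 =>
        if i.2.2 = 0 then (if ax k (i.1, i.2.1) then half else (0 : unitInterval))
        else if i.2.2 = 1 then q else 1)).map (cfg k) =
      (bondPercolation (zdGraph 2) q).map (refineConfig k) := by
  set P : Site 2 × Fin 2 × Fin 3 → unitInterval := fun i =>
    if i.2.2 = 0 then (if ax k (i.1, i.2.1) then half else (0 : unitInterval))
    else if i.2.2 = 1 then q else 1 with hP
  have h2 : ∀ᵐ S ∂prodBernoulli P, ∀ (u : Site 2) (d : Fin 2), (u, d, (2 : Fin 3)) ∈ S := by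
    have h : ∀ t : Site 2 × Fin 2, ∀ᵐ S ∂prodBernoulli P, (t.1, t.2, (2 : Fin 3)) ∈ S :=
      fun t => prodBernoulli_ae_mem _ (by simp [hP])
    filter_upwards [ae_all_iff.2 h] with S hS u d using hS (u, d)
  have h0 : ∀ᵐ S ∂prodBernoulli P,
      ∀ e : Site 2 × Fin 2, ¬ IsAxialEdge k e → (e.1, e.2, (0 : Fin 3)) ∉ S := by
    have h : ∀ e : Site 2 × Fin 2, ∀ᵐ S ∂prodBernoulli P,
        ¬ IsAxialEdge k e → (e.1, e.2, (0 : Fin 3)) ∉ S := by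
      intro e
      by_cases hax : ax k e
      · exact ae_of_all _ fun _ h => absurd hax h
      · have hPe : P (e.1, e.2, 0) = 0 := by simp [hP, hax]
        filter_upwards [prodBernoulli_ae_notMem _ hPe] with S hS _ using hS
    exact ae_all_iff.2 h
  have hae : (cfg k : Set (Site 2 × Fin 2 × Fin 3) → BondConfig (Site 2))
      =ᵐ[prodBernoulli P] refineConfig k ∘ edgeConfig ∘ sharedLayer := by
    filter_upwards [h2, h0] with S hS2 hS0
    exact refinementConfig_eq_refineConfig hS2 hS0
  have hshared : (prodBernoulli P).map sharedLayer = prodBernoulli (fun _ : Site 2 × Fin 2 => q) := by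
    rw [show sharedLayer = fun S => (fun t : Site 2 × Fin 2 => (t.1, t.2, (1 : Fin 3))) ⁻¹' S from rfl,
      prodBernoulli_map_preimage _ (layerEmbedding_injective 1)]
    simp [hP]
  rw [Measure.map_congr hae,
    ← Measure.map_map (measurable_refineConfig k) (measurable_edgeConfig.comp measurable_sharedLayer),
    ← Measure.map_map measurable_edgeConfig measurable_sharedLayer, hshared, prodBernoulli_const,
    setBernoulli_univ_map_edgeConfig]

/-- **The extended law at `ρ = 1` is stochastically increasing in `c`** (from `c = 0`) on increasing
events: monotone coupling by uniform labels (`prodBernoulli_eq_map_labels`), the selectors being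
untouched and the read-out increasing in the other coins (`refinementConfig_mono_of_selector_iff`). -/
theorem map_cfg_zero_le_map_cfg (k : ℕ) (c q : unitInterval) {A : Set (BondConfig (Site 2))}
    (hA : IsUpperSet A) (hAm : MeasurableSet A) :
    (prodBernoulli (fun i : Site 2 × Fin 2 × Fin 3 =>
        if i.2.2 = 0 then (if ax k (i.1, i.2.1) then half else (0 : unitInterval))
        else if i.2.2 = 1 then q else 1)).map (cfg k) A ≤
      (prodBernoulli (fun i : Site 2 × Fin 2 × Fin 3 =>
        if i.2.2 = 0 then (if ax k (i.1, i.2.1) then half else c)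
        else if i.2.2 = 1 then q else 1)).map (cfg k) A := by
  set P₀ : Site 2 × Fin 2 × Fin 3 → unitInterval := fun i =>
    if i.2.2 = 0 then (if ax k (i.1, i.2.1) then half else (0 : unitInterval))
    else if i.2.2 = 1 then q else 1 with hP₀
  set P : Site 2 × Fin 2 × Fin 3 → unitInterval := fun i =>
    if i.2.2 = 0 then (if ax k (i.1, i.2.1) then half else c)
    else if i.2.2 = 1 then q else 1 with hP
  have hle : ∀ i, P₀ i ≤ P i := by
    rintro ⟨x, d, j⟩
    fin_cases j
    · by_cases hax : ax k (x, d)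
      · simp [hP₀, hP, hax]
      · simp only [hP₀, hP, hax, Fin.zero_eta, Fin.isValue, ↓reduceIte]
        exact Subtype.coe_le_coe.1 (by simpa using unitInterval.nonneg c)
    · simp [hP₀, hP]
    · simp [hP₀, hP]
  rw [Measure.map_apply (measurable_cfg k) hAm, Measure.map_apply (measurable_cfg k) hAm,
    prodBernoulli_eq_map_labels P₀, prodBernoulli_eq_map_labels P,
    Measure.map_apply (measurable_labelConfig _) (measurable_cfg k hAm),
    Measure.map_apply (measurable_labelConfig _) (measurable_cfg k hAm)]
  refine measure_mono fun U hU => ?_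
  simp only [Set.mem_preimage] at hU ⊢
  refine hA (refinementConfig_mono_of_selector_iff ?_ ?_) hU
  · intro i hi
    exact le_trans hi (Subtype.coe_le_coe.2 (hle i))
  · intro u d
    simp [hP₀, hP]

/-! ## Coarse long crossings: Kesten's theorem on `kℤ²`, subdivided -/

/-- **Sharp threshold**: for `q > 1/2`, an integer aspect ratio `R > 1` and `ε > 0`,
`h_q(R m, m) ≥ 1 - ε` for all `m ≥ m₀` (`BollobasRiordan2006_ch3_lemma8_holds` and `m^{-γ} → 0`). -/
theorem crossingProb_long_ge_of_half_lt {q : unitInterval} (hq : 1 / 2 < (q : ℝ)) {R : ℕ} (hR : 1 < R)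
    {ε : ℝ} (hε : 0 < ε) :
    ∃ m₀ : ℕ, 1 ≤ m₀ ∧ ∀ m : ℕ, m₀ ≤ m → 1 - ε ≤ crossingProb q (R * m - 1) (m - 1) := by
  obtain ⟨γ, hγ, hρ⟩ := BollobasRiordan2006_ch3_lemma8_holds q hq
  obtain ⟨n₀, hn₀, hn⟩ := hρ R hR
  have h0 : Tendsto (fun n : ℕ => (n : ℝ) ^ (-γ)) atTop (𝓝 0) :=
    (tendsto_rpow_neg_atTop hγ).comp tendsto_natCast_atTop_atTop
  obtain ⟨n₁, hn₁⟩ := eventually_atTop.1 (h0.eventually (eventually_le_nhds hε))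
  refine ⟨max n₀ n₁, le_max_of_le_left hn₀, fun m hm => ?_⟩
  have h1 := hn m (le_of_max_le_left hm)
  have h2 : (m : ℝ) ^ (-γ) ≤ ε := hn₁ m (le_of_max_le_right hm)
  linarith

/-- **Coarse-to-fine**: `P_q(𝓒(a, b)) ≤ (P_q ∘ (refineConfig k)⁻¹)(𝓒(ka, kb))` (`k ≥ 1`) — a coarse
crossing subdivides into a fine one (`refineConfig_mem_crossing`). -/
theorem real_crossing_le_map_refineConfig {k : ℕ} (hk : 0 < k) (q : unitInterval) (a b : ℕ) :
    (bondPercolation (zdGraph 2) q).real (KST2023.crossing a b) ≤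
      ((bondPercolation (zdGraph 2) q).map (refineConfig k)).real (KST2023.crossing (k * a) (k * b)) := by
  have hmeas : MeasurableSet (KST2023.crossing (k * a) (k * b)) :=
    measurableSet_openCrossing_of_countable _ _ _
  rw [map_measureReal_apply (measurable_refineConfig k) hmeas]
  simp only [measureReal_def]
  refine ENNReal.toReal_mono (measure_ne_top _ _) (measure_mono_ae ?_)
  filter_upwards [ae_subset_edgeSet (zdGraph 2) q] with ω hω h
  exact refineConfig_mem_crossing hk hω h

/-- **Long crossings of the subdivided supercritical coarse model**: for `q > 1/2`, `k ≥ 1`, `M` and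
`ε > 0`, the fine box `[-M N, M N] × [-N, N]` is crossed the long way with probability `≥ 1 - ε` for
`N ≥ N₁` — it contains the subdivision of the coarse box `[-A, A] × [-B, B]`, `B = ⌊N/k⌋`,
`A = ⌊M N/k⌋ + 1`, crossed with probability `h_q(2A+1, 2B+1) ≥ h_q((2M+4)(2B+1), 2B+1) → 1`. -/
theorem long_crossings_map_refineConfig {k : ℕ} (hk : 0 < k) {q : unitInterval}
    (hq : 1 / 2 < (q : ℝ)) (M : ℕ) {ε : ℝ} (hε : 0 < ε) :
    ∃ N₁ : ℕ, ∀ N : ℕ, N₁ ≤ N →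
      1 - ε ≤ ((bondPercolation (zdGraph 2) q).map (refineConfig k)).real
        (KSTPeriodic.crossing 0 (M * N) N) := by
  obtain ⟨m₀, -, hm⟩ := crossingProb_long_ge_of_half_lt hq (R := 2 * M + 4) (by omega) hε
  refine ⟨k * m₀, fun N hN => ?_⟩
  set B : ℕ := N / k
  set A : ℕ := M * N / k + 1 with hA
  have hkB : k * B ≤ N := Nat.mul_div_le N k
  have hBm : m₀ ≤ B := (Nat.le_div_iff_mul_le hk).2 (by rw [mul_comm]; exact hN)
  have hMA : M * N ≤ k * A := (Nat.lt_mul_div_succ (M * N) hk).le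
  have hNk : N ≤ k * B + k := (Nat.lt_mul_div_succ N hk).le.trans (Nat.mul_succ k B).le
  have hdiv : M * N / k ≤ M * B + M := by
    refine Nat.div_le_of_le_mul ?_
    calc M * N ≤ M * (k * B + k) := Nat.mul_le_mul_left M hNk
      _ = k * (M * B + M) := by ring
  have hexp : (2 * M + 4) * (2 * B + 1) = 4 * (M * B) + 2 * M + 8 * B + 4 := by ring
  have hA2 : 2 * A ≤ (2 * M + 4) * (2 * B + 1) - 1 := by
    rw [hexp]
    omega
  have hL : KSTPeriodic.LatticeCarried ((bondPercolation (zdGraph 2) q).map (refineConfig k)) := by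
    rw [← map_cfg_zero_one_eq_map_refineConfig]
    exact latticeCarried_map_cfg k _
  haveI : IsProbabilityMeasure ((bondPercolation (zdGraph 2) q).map (refineConfig k)) :=
    Measure.isProbabilityMeasure_map (measurable_refineConfig k).aemeasurable
  calc 1 - ε ≤ crossingProb q ((2 * M + 4) * (2 * B + 1) - 1) (2 * B + 1 - 1) :=
        hm (2 * B + 1) (by omega)
    _ ≤ crossingProb q (2 * A) (2 * B) := by
        rw [Nat.add_sub_cancel]
        exact crossingProb_anti_left q hA2 _
    _ = (bondPercolation (zdGraph 2) q).real (KST2023.crossing A B) :=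
        (bondPercolation_real_crossing q A B).symm
    _ ≤ ((bondPercolation (zdGraph 2) q).map (refineConfig k)).real
          (KST2023.crossing (k * A) (k * B)) := real_crossing_le_map_refineConfig hk q A B
    _ = ((bondPercolation (zdGraph 2) q).map (refineConfig k)).real
          (KSTPeriodic.crossing 0 (k * A) (k * B)) := by rw [KSTPeriodic.crossing_zero_eq]
    _ ≤ ((bondPercolation (zdGraph 2) q).map (refineConfig k)).real
          (KSTPeriodic.crossing 0 (M * N) N) := KSTPeriodic.real_crossing_mono hL hMA hkB

/-! ## Hard-way boxes of the drawing `√2 ℤ²` under the extended law at `ρ = 1` -/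

/-- **Hard-way boxes at `ρ = 1`, `q > 1/2` (unit-interval parameters).**  For `k ≥ 1` and `ε > 0`,
at all large `n`, for all `w ∈ ℂ` and every interior bias `c`, the `8n × n` rectangle at `w` is
crossed horizontally and the `n × 8n` one vertically with probability `≥ 1 - ε` under the extended
law (own coins fair on axial edges and `c` on interior edges, shared coins `q`, selectors on). -/
theorem hardWayBoxes_one_of_half_lt_unitInterval {k : ℕ} (hk : 0 < k) {q : unitInterval}
    (hq : 1 / 2 < (q : ℝ)) {ε : ℝ} (hε : 0 < ε) :
    ∃ n₀ : ℕ, ∀ n : ℕ, n₀ ≤ n → ∀ (w : ℂ) (c : unitInterval),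
      1 - ε ≤ ((prodBernoulli (fun i : Site 2 × Fin 2 × Fin 3 =>
          if i.2.2 = 0 then (if ax k (i.1, i.2.1) then half else c)
          else if i.2.2 = 1 then q else 1)).map (cfg k)).real
        (embRectCrossing (fun v => squareLatticeEmbedding.z v - w) (8 * n) n) ∧
      1 - ε ≤ ((prodBernoulli (fun i : Site 2 × Fin 2 × Fin 3 =>
          if i.2.2 = 0 then (if ax k (i.1, i.2.1) then half else c)
          else if i.2.2 = 1 then q else 1)).map (cfg k)).real
        (embTBCrossing (fun v => squareLatticeEmbedding.z v - w) n (8 * n)) := by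
  -- the law at `c = 0`
  set P₀ : Site 2 × Fin 2 × Fin 3 → unitInterval := fun i =>
    if i.2.2 = 0 then (if ax k (i.1, i.2.1) then half else (0 : unitInterval))
    else if i.2.2 = 1 then q else 1 with hP₀
  set ν : Measure (BondConfig (Site 2)) := (prodBernoulli P₀).map (cfg k) with hν
  haveI : IsProbabilityMeasure ν := Measure.isProbabilityMeasure_map (measurable_cfg k).aemeasurable
  have hident : ν = (bondPercolation (zdGraph 2) q).map (refineConfig k) :=
    map_cfg_zero_one_eq_map_refineConfig k q
  have hFKG : IsPositivelyAssociated ν := by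
    rw [hident]
    exact (isPositivelyAssociated_bondPercolation (zdGraph 2) q).map (refineConfig_mono k)
      (measurable_refineConfig k)
  have hP0 : ∀ e e' : Site 2 × Fin 2, (IsAxialEdge k e ↔ IsAxialEdge k e') →
      P₀ (e.1, e.2, 0) = P₀ (e'.1, e'.2, 0) := by
    intro e e' h
    by_cases hax : ax k e
    · have hax' : ax k e' := h.1 hax
      simp [hP₀, hax, hax']
    · have hax' : ¬ ax k e' := fun h' => hax (h.2 h')
      simp [hP₀, hax, hax']
  have hAdm : KSTPeriodic.Admissible k 0 ν :=
    admissible_map_cfg (Nat.pos_iff_ne_zero.1 hk) (fun _ πt h2 => param_coinReindex hP0 (fun _ _ => by simp [hP₀])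
      (fun _ _ => by simp [hP₀]) πt h2) hFKG
  have hL : KSTPeriodic.LatticeCarried ν := latticeCarried_map_cfg k P₀
  obtain ⟨N₁, hN₁⟩ := long_crossings_map_refineConfig hk hq (8 * (⌈(8 : ℝ)⌉₊ + 1)) hε  -- ratio 72
  have hlong : ∀ N : ℕ, N₁ ≤ N →
      1 - ε ≤ ν.real (KSTPeriodic.crossing 0 (8 * (⌈(8 : ℝ)⌉₊ + 1) * N) N) := by
    intro N hN
    rw [hident]
    exact hN₁ N hN
  refine ⟨8 * (N₁ + k + 2) + 64, fun n hn w c => ?_⟩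
  have hn' : 8 * ((N₁ : ℝ) + k + 2) + 8 * 8 ≤ n := by
    have : ((8 * (N₁ + k + 2) + 64 : ℕ) : ℝ) ≤ n := by exact_mod_cast hn
    push_cast at this
    linarith
  -- horizontal boxes, all translates, at `c = 0`
  have hH : ∀ w' : ℂ,
      1 - ε ≤ ν.real (embRectCrossing (fun v => squareLatticeEmbedding.z v - w') (8 * n) n) :=
    fun w' => RswCertSandwich.embRectCrossing_lower hk hAdm hL (a := 8) (by norm_num) hlong hn' w'
  -- vertical boxes by transposition; then raise `c` by the monotone coupling
  have hV : 1 - ε ≤ ν.real (embTBCrossing (fun v => squareLatticeEmbedding.z v - w) n (8 * n)) := by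
    rw [RswCertSandwich.real_embTBCrossing_eq_real_embRectCrossing_of_transpose hAdm.transpose_inv]
    exact hH _
  exact ⟨(hH w).trans (ENNReal.toReal_mono (measure_ne_top _ _) (map_cfg_zero_le_map_cfg k c q
      (isUpperSet_embRectCrossing _ _ _) (measurableSet_openCrossing_of_countable _ _ _))),
    hV.trans (ENNReal.toReal_mono (measure_ne_top _ _) (map_cfg_zero_le_map_cfg k c q
      (isUpperSet_embTBCrossing _ _ _) (measurableSet_openCrossing_of_countable _ _ _)))⟩

/-- **Brick (i) of stub `stub_cornerHardWayBoxes` (HWB): hard-way boxes of the extended family at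
`ρ = 1` above the coarse threshold.**  For `k ≥ 1`, `p > 1/2` and `ε > 0` there is `n₀` such that for
all `n ≥ n₀`, every `w ∈ ℂ` and every interior parameter `c`, under the extended law `M_k(1, c; p)` —
the coin law `prm k 1 c` with the shared-coin bias `1/2` replaced by `p` (real parameters clamped to
`[0, 1]` as in `prm`), pushed forward by `cfg k` — the translate by `w` of the `8n × n` rectangle of
the drawing `squareLatticeEmbedding.z = √2 ℤ²` is crossed horizontally, and that of the `n × 8n`
rectangle vertically, each with probability `≥ 1 - ε` (at `c = 0`: Kesten's theorem on `kℤ²` in the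
sharp-threshold form of Bollobás–Riordan 2006, Ch. 3, Lemma 8; every `c` by monotonicity). -/
theorem hardWayBoxes_one_of_half_lt :
    ∀ k : ℕ, 0 < k → ∀ p : ℝ, 1 / 2 < p → ∀ ε : ℝ, 0 < ε → ∃ n₀ : ℕ, ∀ n : ℕ, n₀ ≤ n →
      ∀ (w : ℂ) (c : ℝ),
        1 - ε ≤ ((prodBernoulli (fun i : Site 2 × Fin 2 × Fin 3 =>
            if i.2.2 = 0 then (if ax k (i.1, i.2.1) then half else Set.projIcc (0 : ℝ) 1 zero_le_one c)
            else if i.2.2 = 1 then Set.projIcc (0 : ℝ) 1 zero_le_one p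
            else Set.projIcc (0 : ℝ) 1 zero_le_one 1)).map (cfg k)).real
          (embRectCrossing (fun v => squareLatticeEmbedding.z v - w) (8 * n) n) ∧
        1 - ε ≤ ((prodBernoulli (fun i : Site 2 × Fin 2 × Fin 3 =>
            if i.2.2 = 0 then (if ax k (i.1, i.2.1) then half else Set.projIcc (0 : ℝ) 1 zero_le_one c)
            else if i.2.2 = 1 then Set.projIcc (0 : ℝ) 1 zero_le_one p
            else Set.projIcc (0 : ℝ) 1 zero_le_one 1)).map (cfg k)).real
          (embTBCrossing (fun v => squareLatticeEmbedding.z v - w) n (8 * n)) := by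
  intro k hk p hp ε hε
  have hq : 1 / 2 < ((Set.projIcc (0 : ℝ) 1 zero_le_one p : unitInterval) : ℝ) := by
    rw [Set.coe_projIcc]
    exact lt_max_of_lt_right (lt_min one_half_lt_one hp)
  obtain ⟨n₀, h⟩ := hardWayBoxes_one_of_half_lt_unitInterval hk hq hε
  refine ⟨n₀, fun n hn w c => ?_⟩
  simpa only [projIcc_unitInterval_one] using h n hn w (Set.projIcc (0 : ℝ) 1 zero_le_one c)

end Summit.CriticalPhenomena.CardyFormulaZ2.Theorems.CardySelfRefinement

end
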